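import Summits.NavierStokesRegularity.FluidComputer.AbcLatticeSymmetry

/-!
# The two generators of the ABC flow's symmetry group on the Fourier lattice, and the invariance of
# symmetry class II under the linearised operator
(instab3 g4 — implementation 1 of the skew-cut X0 certifier, cell `ns-blowup`, 2026-08-26)

HONEST FRAMING (human ruling D-0035): nothing here is a claim about Navier–Stokes blow-up.
WHAT THIS IS NOT: not NS evidence. MODEL lane — sequel of `AbcLatticeSymmetry` (generic equivariance
under signed-permutation lattice symmetries `(ρ c)(k) = θ(k) M c(Mᵀk)` that fix the ABC coefficients).
Here the hypothesis «`ρ â = â`» is DISCHARGED for the two generators of the 24-element symmetry group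
`Γ ≅ O` of `U = abcFlow A A A` (equal amplitudes; found by exact search over signed permutations `M`
and quarter-period shifts `t`, `U(Mx + t) = M U(x)`; HOME/instab3 scratch/absym.py):

* `r : x ↦ (x₁, x₂, x₀)` — `(M_r v)ₚ = v_{p+1}`, `(M_rᵀ k)ᵢ = k_{i+2}`, `t = 0`, `θ_r = 1`; order 3,
  sign character `χ_II(r) = +1` (`abcFourier_invariant_r`);
* `s : x ↦ (x₀ + ¼, x₂ + ¾, −x₁ + ¼)` — `M_s v = (v₀, v₂, −v₁)` (`π = (1 2)`, `σ = (1, 1, −1)`),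
  `M_sᵀ k = (k₀, −k₂, k₁)`, `θ_s(k) = e^{−2πi k·t} = (−i)^{k₀ + 3k₁ + k₂}`; order 4, `χ_II(s) = −1`
  (`abcFourier_invariant_s`);
* `⟨r, s⟩ = Γ` (all 24 elements; linear parts = the rotation group of the cube, `det = +1`), so CLASS II
  (the sign representation, INSTAB3-METHOD §1: «II (sign)») `= {c : ρ_r c = c, ρ_s c = −c}`;
* `linOp_abcFlow_classII_invariant` — **class II is invariant under the linearised lattice operator**
  `c ↦ ν·4π²|k|²c + Π[N(â,c) + N(c,â)]` about `abcFlow A A A` (KERNEL-CHAIN (A5), class restriction P3,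
  in the tree's lattice vocabulary; with `AbcLinearisedLattice` §4 the same holds for the certifiers'
  `P[U × (curl v − v)] + νΔ`).

Also: `mem_abcFreq_iff_freqNormSq_eq_one` (the ABC shell is the unit sphere of `ℤ³`).
Mathlib + `AbcLatticeSymmetry`; no definitions.
-/

noncomputable section

open scoped BigOperators Topology InnerProductSpace ComplexConjugate
open Filter Set Function MeasureTheory UnitAddTorus Finset

namespace Summit.NavierStokesRegularity.FluidComputer.AbcLatticeSymmetryGenerators

open Literature.Analysis.FluidPDE Literature.Analysis.FluidPDE.SteadyLattice
open Literature.Analysis.FunctionSpaces Literature.Analysis.FunctionSpaces.Torus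
open Literature.Analysis.FunctionSpaces.EuclideanSpace
open Literature.Analysis.FluidPDE.ScalarFourier
open AbcLatticeSymmetry

/-! ### §1 The ABC shell is the unit sphere of the lattice -/

/-- `k ∈ {±e₀, ±e₁, ±e₂} ↔ |k|² = 1` on `ℤ³`. -/
theorem mem_abcFreq_iff_freqNormSq_eq_one (k : Fin 3 → ℤ) : k ∈ Torus.abcFreq ↔ freqNormSq k = 1 := by
  constructor
  · intro hk
    obtain ⟨y, rfl⟩ := Torus.mem_abcFreq.mp hk
    exact Torus.freqNormSq_abcDir y
  · intro h
    have hZ : k 0 ^ 2 + k 1 ^ 2 + k 2 ^ 2 = 1 := by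
      have h' : ((k 0 : ℝ)) ^ 2 + ((k 1 : ℝ)) ^ 2 + ((k 2 : ℝ)) ^ 2 = 1 := by
        rw [freqNormSq, Fin.sum_univ_three] at h; exact h
      exact_mod_cast h'
    have h0 : k 0 ≤ 1 := by nlinarith [sq_nonneg (k 1), sq_nonneg (k 2)]
    have h0' : -1 ≤ k 0 := by nlinarith [sq_nonneg (k 1), sq_nonneg (k 2)]
    have h1 : k 1 ≤ 1 := by nlinarith [sq_nonneg (k 0), sq_nonneg (k 2)]
    have h1' : -1 ≤ k 1 := by nlinarith [sq_nonneg (k 0), sq_nonneg (k 2)]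
    have h2 : k 2 ≤ 1 := by nlinarith [sq_nonneg (k 0), sq_nonneg (k 1)]
    have h2' : -1 ≤ k 2 := by nlinarith [sq_nonneg (k 0), sq_nonneg (k 1)]
    have hk : k = ![k 0, k 1, k 2] := by funext i; fin_cases i <;> rfl
    rw [hk]
    generalize k 0 = a at hZ h0 h0' ⊢
    generalize k 1 = b at hZ h1 h1' ⊢
    generalize k 2 = c at hZ h2 h2' ⊢
    interval_cases a <;> interval_cases b <;> interval_cases c <;> first | (exfalso; omega) | decide

/-- Off the shell the ABC coefficients vanish; on it they are `abcCoeff`. -/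
theorem abcFourier_eq (A B C : ℝ) (m : Fin 3 → ℤ) :
    mFourierCoeff (complexify ∘ Torus.abcFlow A B C) m =
      if freqNormSq m = 1 then Torus.abcCoeff A B C m else 0 := by
  rw [Torus.mFourierCoeff_abcFlow]
  by_cases h : freqNormSq m = 1
  · rw [if_pos ((mem_abcFreq_iff_freqNormSq_eq_one m).mpr h), if_pos h]
  · rw [if_neg (fun hm => h ((mem_abcFreq_iff_freqNormSq_eq_one m).mp hm)), if_neg h]

/-! ### §2 The generator `r : x ↦ (x₁, x₂, x₀)` (order 3, `θ = 1`, `χ_II = +1`) -/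

/-- The inverse of the cyclic rotation of `Fin 3`: `(finRotate 3)⁻¹ i = i + 2`. -/
theorem finRotate_three_symm_apply (i : Fin 3) : (finRotate 3).symm i = i + 2 := by
  fin_cases i <;> decide

/-- **The ABC coefficients (equal amplitudes) are invariant under `r`**: `â(k)ₚ = â(M_rᵀ k)_{p+1}`,
`(M_rᵀ k)ᵢ = k_{i+2}` — in the generic shape of `AbcLatticeSymmetry` with `π = finRotate 3`, `σ = 1`,
`θ = 1`. -/
theorem abcFourier_invariant_r (A : ℝ) (m : Fin 3 → ℤ) (p : Fin 3) :
    (mFourierCoeff (complexify ∘ Torus.abcFlow A A A)) m p = (fun _ : Fin 3 → ℤ => (1 : ℂ)) m *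
      ((((fun _ : Fin 3 => (1 : ℤ)) p : ℤ) : ℂ) * (mFourierCoeff (complexify ∘ Torus.abcFlow A A A))
        (fun i : Fin 3 => (fun _ : Fin 3 => (1 : ℤ)) ((finRotate 3).symm i) * m ((finRotate 3).symm i))
        ((finRotate 3) p)) := by
  simp only [finRotate_three_symm_apply, finRotate_apply, one_mul, Int.cast_one]
  have hn : freqNormSq (fun i : Fin 3 => m (i + 2)) = freqNormSq m := by
    simp only [freqNormSq, Fin.sum_univ_three, Fin.isValue]
    have e0 : ((0 : Fin 3) + 2) = 2 := by decide
    have e1 : ((1 : Fin 3) + 2) = 0 := by decide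
    have e2 : ((2 : Fin 3) + 2) = 1 := by decide
    rw [e0, e1, e2]; ring
  rw [abcFourier_eq, abcFourier_eq, hn]
  by_cases h : freqNormSq m = 1
  · rw [if_pos h, if_pos h]
    obtain ⟨⟨j, b⟩, rfl⟩ := Torus.mem_abcFreq.mp ((mem_abcFreq_iff_freqNormSq_eq_one m).mpr h)
    fin_cases j <;> cases b <;> fin_cases p <;>
      simp [Torus.abcCoeff_apply, Torus.abcDir_apply, Torus.abcAmp, Fin.isValue]
  · rw [if_neg h, if_neg h]
    simp

/-- Signs and character of `r` (trivial): `σ_r² = 1`, `θ_r(m) θ_r(k − m) = θ_r(k)`. -/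
theorem sigma_theta_r :
    (∀ p : Fin 3, (fun _ : Fin 3 => (1 : ℤ)) p * (fun _ : Fin 3 => (1 : ℤ)) p = 1) ∧
      ∀ k m : Fin 3 → ℤ, (fun _ : Fin 3 → ℤ => (1 : ℂ)) m * (fun _ : Fin 3 → ℤ => (1 : ℂ)) (k - m) =
        (fun _ : Fin 3 → ℤ => (1 : ℂ)) k :=
  ⟨fun _ => by simp, fun _ _ => by simp⟩

/-! ### §3 The generator `s : x ↦ (x₀ + ¼, x₂ + ¾, −x₁ + ¼)` (order 4, `θ_s = (−i)^{k₀+3k₁+k₂}`, `χ_II = −1`) -/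

/-- `(−i)³ = i`. -/
theorem negI_pow_three : (-Complex.I) ^ 3 = Complex.I := by
  rw [pow_succ, pow_two]; ring_nf; simp

/-- Signs and character of `s`: `σ_s = (1, 1, −1)` has `σ² = 1`, and `θ_s(k) = (−i)^{k₀ + 3k₁ + k₂}` is a
character of `ℤ³` (`θ_s(m) θ_s(k − m) = θ_s(k)`; `θ_s(k) = e^{−2πi k·t}`, `t = (¼, ¾, ¼)`). -/
theorem sigma_theta_s :
    (∀ p : Fin 3, (![1, 1, -1] : Fin 3 → ℤ) p * (![1, 1, -1] : Fin 3 → ℤ) p = 1) ∧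
      ∀ k m : Fin 3 → ℤ, (fun n : Fin 3 → ℤ => (-Complex.I) ^ (n 0 + 3 * n 1 + n 2)) m *
        (fun n : Fin 3 → ℤ => (-Complex.I) ^ (n 0 + 3 * n 1 + n 2)) (k - m) =
        (fun n : Fin 3 → ℤ => (-Complex.I) ^ (n 0 + 3 * n 1 + n 2)) k := by
  refine ⟨fun p => by fin_cases p <;> simp, fun k m => ?_⟩
  have hI : (-Complex.I) ≠ 0 := neg_ne_zero.mpr Complex.I_ne_zero
  simp only [Pi.sub_apply]
  rw [← zpow_add₀ hI]
  congr 1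
  ring

/-- **The ABC coefficients (equal amplitudes) are invariant under `s`**:
`â(k)ₚ = θ_s(k) σₚ â(M_sᵀ k)_{π p}` with `π = (1 2)`, `σ = (1, 1, −1)`, `M_sᵀ k = (k₀, −k₂, k₁)`,
`θ_s(k) = (−i)^{k₀ + 3k₁ + k₂}` — in the generic shape of `AbcLatticeSymmetry`. -/
theorem abcFourier_invariant_s (A : ℝ) (m : Fin 3 → ℤ) (p : Fin 3) :
    (mFourierCoeff (complexify ∘ Torus.abcFlow A A A)) m p =
      (fun n : Fin 3 → ℤ => (-Complex.I) ^ (n 0 + 3 * n 1 + n 2)) m *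
      ((((![1, 1, -1] : Fin 3 → ℤ) p : ℤ) : ℂ) * (mFourierCoeff (complexify ∘ Torus.abcFlow A A A))
        (fun i : Fin 3 => (![1, 1, -1] : Fin 3 → ℤ) ((Equiv.swap (1 : Fin 3) 2).symm i) *
          m ((Equiv.swap (1 : Fin 3) 2).symm i)) ((Equiv.swap (1 : Fin 3) 2) p)) := by
  have hT : (fun i : Fin 3 => (![1, 1, -1] : Fin 3 → ℤ) ((Equiv.swap (1 : Fin 3) 2).symm i) *
      m ((Equiv.swap (1 : Fin 3) 2).symm i)) = ![m 0, -m 2, m 1] := by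
    funext i
    fin_cases i <;> simp [Equiv.swap_apply_of_ne_of_ne]
  have hn : freqNormSq (![m 0, -m 2, m 1] : Fin 3 → ℤ) = freqNormSq m := by
    simp only [freqNormSq, Fin.sum_univ_three, Fin.isValue, Matrix.cons_val_zero, Matrix.cons_val_one,
      Matrix.cons_val]
    push_cast
    ring
  rw [hT, abcFourier_eq, abcFourier_eq, hn]
  by_cases h : freqNormSq m = 1
  · rw [if_pos h, if_pos h]
    obtain ⟨⟨j, b⟩, rfl⟩ := Torus.mem_abcFreq.mp ((mem_abcFreq_iff_freqNormSq_eq_one m).mpr h)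
    fin_cases j <;> cases b <;> fin_cases p <;>
      simp [Torus.abcCoeff_apply, Torus.abcDir_apply, Torus.abcAmp, Fin.isValue,
        Equiv.swap_apply_of_ne_of_ne, zpow_ofNat, negI_pow_three, Complex.ext_iff, neg_div]
  · rw [if_neg h, if_neg h]
    simp

/-! ### §4 Class II is invariant under the linearised operator -/

/-- **Class restriction P3 for the X0 chain.** Let `c : ℤ³ → ℂ³` lie in symmetry CLASS II of the ABC flow
`U = abcFlow A A A`: `ρ_r c = c` and `ρ_s c = −c` for the two generators `r, s` of the 24-group `Γ`
(sign character; in the lattice form `(ρ c)(k) = θ(k) M c(Mᵀk)` of `AbcLatticeSymmetry`, written with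
the data `(π, σ, θ)` of the generators). Then the image `L c`,
`(L c)(k) = ν·4π²|k|² c(k) + Π_k [N(â, c)(k) + N(c, â)(k)]`, again satisfies `ρ_r (L c) = L c` and
`ρ_s (L c) = −(L c)`: class II is an invariant subspace of the linearised lattice operator (hence of
`P[U × (curl v − v)] + νΔ`, `AbcLinearisedLattice` §4), as the certificates assume. -/
theorem linOp_abcFlow_classII_invariant (A ν : ℝ) (c : (Fin 3 → ℤ) → EuclideanSpace ℂ (Fin 3))
    (hr : ∀ (m : Fin 3 → ℤ) (p : Fin 3), (fun _ : Fin 3 → ℤ => (1 : ℂ)) m *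
        ((((fun _ : Fin 3 => (1 : ℤ)) p : ℤ) : ℂ) * c
          (fun i : Fin 3 => (fun _ : Fin 3 => (1 : ℤ)) ((finRotate 3).symm i)
            * m ((finRotate 3).symm i)) ((finRotate 3) p)) = 1 * c m p)
    (hs : ∀ (m : Fin 3 → ℤ) (p : Fin 3), (fun n : Fin 3 → ℤ => (-Complex.I) ^ (n 0 + 3 * n 1 + n 2)) m *
        ((((![1, 1, -1] : Fin 3 → ℤ) p : ℤ) : ℂ) * c
          (fun i : Fin 3 => (![1, 1, -1] : Fin 3 → ℤ) ((Equiv.swap (1 : Fin 3) 2).symm i)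
            * m ((Equiv.swap (1 : Fin 3) 2).symm i)) ((Equiv.swap (1 : Fin 3) 2) p)) = (-1) * c m p) :
    (∀ (k : Fin 3 → ℤ) (p : Fin 3),
        (fun _ : Fin 3 → ℤ => (1 : ℂ)) k *
          ((((fun _ : Fin 3 => (1 : ℤ)) p : ℤ) : ℂ) *
            ((((ν * (4 * Real.pi ^ 2 * freqNormSq
              (fun i : Fin 3 => (fun _ : Fin 3 => (1 : ℤ)) ((finRotate 3).symm i)
                * k ((finRotate 3).symm i)))) : ℝ) : ℂ) •
                c (fun i : Fin 3 => (fun _ : Fin 3 => (1 : ℤ)) ((finRotate 3).symm i) * k ((finRotate 3).symm i)) +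
              Torus.lerayCoeff (fun i : Fin 3 => (fun _ : Fin 3 => (1 : ℤ)) ((finRotate 3).symm i)
                * k ((finRotate 3).symm i))
                ((WithLp.toLp 2 (fun pp : Fin 3 => transportSym
                    (fun jj mm => (mFourierCoeff (complexify ∘ Torus.abcFlow A A A)) mm jj) (fun mm => c mm pp)
                    (fun i : Fin 3 => (fun _ : Fin 3 => (1 : ℤ)) ((finRotate 3).symm i)
                      * k ((finRotate 3).symm i))) : EuclideanSpace ℂ (Fin 3)) +
                  (WithLp.toLp 2 (fun pp : Fin 3 => transportSym (fun jj mm => c mm jj)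
                    (fun mm => (mFourierCoeff (complexify ∘ Torus.abcFlow A A A)) mm pp)
                    (fun i : Fin 3 => (fun _ : Fin 3 => (1 : ℤ)) ((finRotate 3).symm i)
                      * k ((finRotate 3).symm i))) : EuclideanSpace ℂ (Fin 3))))
              ((finRotate 3) p)) =
        1 * ((((ν * (4 * Real.pi ^ 2 * freqNormSq k)) : ℝ) : ℂ) • c k +
          Torus.lerayCoeff k ((WithLp.toLp 2 (fun pp : Fin 3 => transportSym
              (fun jj mm => (mFourierCoeff (complexify ∘ Torus.abcFlow A A A)) mm jj) (fun mm => c mm pp) k) :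
              EuclideanSpace ℂ (Fin 3)) +
            (WithLp.toLp 2 (fun pp : Fin 3 => transportSym (fun jj mm => c mm jj)
              (fun mm => (mFourierCoeff (complexify ∘ Torus.abcFlow A A A)) mm pp) k) : EuclideanSpace ℂ (Fin 3))))
          p) ∧
    (∀ (k : Fin 3 → ℤ) (p : Fin 3),
        (fun n : Fin 3 → ℤ => (-Complex.I) ^ (n 0 + 3 * n 1 + n 2)) k *
          ((((![1, 1, -1] : Fin 3 → ℤ) p : ℤ) : ℂ) *
            ((((ν * (4 * Real.pi ^ 2 * freqNormSq
              (fun i : Fin 3 => (![1, 1, -1] : Fin 3 → ℤ) ((Equiv.swap (1 : Fin 3) 2).symm i)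
                * k ((Equiv.swap (1 : Fin 3) 2).symm i)))) : ℝ) : ℂ) •
                c (fun i : Fin 3 => (![1, 1, -1] : Fin 3 → ℤ) ((Equiv.swap (1 : Fin 3) 2).symm i)
                  * k ((Equiv.swap (1 : Fin 3) 2).symm i)) +
              Torus.lerayCoeff
                (fun i : Fin 3 => (![1, 1, -1] : Fin 3 → ℤ) ((Equiv.swap (1 : Fin 3) 2).symm i)
                  * k ((Equiv.swap (1 : Fin 3) 2).symm i))
                ((WithLp.toLp 2 (fun pp : Fin 3 => transportSym
                    (fun jj mm => (mFourierCoeff (complexify ∘ Torus.abcFlow A A A)) mm jj) (fun mm => c mm pp)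
                    (fun i : Fin 3 => (![1, 1, -1] : Fin 3 → ℤ) ((Equiv.swap (1 : Fin 3) 2).symm i)
                      * k ((Equiv.swap (1 : Fin 3) 2).symm i))) : EuclideanSpace ℂ (Fin 3)) +
                  (WithLp.toLp 2 (fun pp : Fin 3 => transportSym (fun jj mm => c mm jj)
                    (fun mm => (mFourierCoeff (complexify ∘ Torus.abcFlow A A A)) mm pp)
                    (fun i : Fin 3 => (![1, 1, -1] : Fin 3 → ℤ) ((Equiv.swap (1 : Fin 3) 2).symm i)
                      * k ((Equiv.swap (1 : Fin 3) 2).symm i))) : EuclideanSpace ℂ (Fin 3))))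
              ((Equiv.swap (1 : Fin 3) 2) p)) =
        (-1) * ((((ν * (4 * Real.pi ^ 2 * freqNormSq k)) : ℝ) : ℂ) • c k +
          Torus.lerayCoeff k ((WithLp.toLp 2 (fun pp : Fin 3 => transportSym
              (fun jj mm => (mFourierCoeff (complexify ∘ Torus.abcFlow A A A)) mm jj) (fun mm => c mm pp) k) :
              EuclideanSpace ℂ (Fin 3)) +
            (WithLp.toLp 2 (fun pp : Fin 3 => transportSym (fun jj mm => c mm jj)
              (fun mm => (mFourierCoeff (complexify ∘ Torus.abcFlow A A A)) mm pp) k) : EuclideanSpace ℂ (Fin 3))))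
          p) :=
  ⟨fun k p => linOp_abcFlow_class_invariant (finRotate 3) (fun _ : Fin 3 => (1 : ℤ)) sigma_theta_r.1
      (fun _ : Fin 3 → ℤ => (1 : ℂ)) sigma_theta_r.2 A A A ν (abcFourier_invariant_r A) 1 c hr k p,
    fun k p => linOp_abcFlow_class_invariant (Equiv.swap (1 : Fin 3) 2) (![1, 1, -1] : Fin 3 → ℤ)
      sigma_theta_s.1 (fun n : Fin 3 → ℤ => (-Complex.I) ^ (n 0 + 3 * n 1 + n 2)) sigma_theta_s.2 A A A ν
      (abcFourier_invariant_s A) (-1) c hs k p⟩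

end Summit.NavierStokesRegularity.FluidComputer.AbcLatticeSymmetryGenerators

end
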